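import Summits.QuantumFields.BalabanUV.Beta.GAN24.DirichletBoxTwoLevel

/-!
# T⁴ programme, spine node NE2 (U1a), sub-row Δ1 «NE2⁰-Dirichlet» — THE DISCRETE `H²` IDENTITY OF A ZERO-EXTENDED FUNCTION ON AN
# ARBITRARY REGION, WITH ITS RE-ENTRANT CORNER TERM, AND THE BUDGET OF A REGION DIRICHLET SOLUTION REDUCED TO ITS CORNER MASS

NE2 formalisation swarm `b2b-balaban-t4-ne2-formalise-*`, LEAF PROVER 09 (gen 10), supplier item «Δ1-SCALAR-CORNER-H2» (journal
`HOME/CLAIMS.log` 2026-08-21 l.23790; owner R42 GO).  Road P2's module M-R `Beta/GAN24/DirichletBoxRegularity` proves, for `z` supported in a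
CORNER-FREE region `Ω` (no exterior site adjacent to `Ω` in two different directions), the discrete `H²` identity
`Σ_{x∈Ω}|(Δz)(x)|² = Hdiag Ω z + Hmixed z` and leaves as LOCATED PROSE: «at a RE-ENTRANT edge of a general union of blocks the exterior
corner site `x ∉ Ω` has `x − e_μ ∈ Ω` AND `x − e_ν ∈ Ω` … the identity acquires a boundary term of indefinite sign supported on re-entrant
edges» — whence their two-level law on general regions is CONDITIONAL on `Hdiag Ω z ≤ κ²·Σ_{x∈Ω}|(Δz)(x)|²`, and leaf-06-g7's
`RegionGaugeColumnsTraceRegion.hBt_of_hB_of_budget` / `hinjK_of_local_of_coercive_of_budget` (p241856) display the scalar budget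
`hΛ : ∀ f, Σ_μ budget M S n μ (solExt f) ≤ Λ·nsq f` on re-entrant regions.  THIS FILE makes the prose a theorem and reduces both displayed
hypotheses to ONE scalar quantity (the scalar twin of leaf-02-g8's `RegionElectricGeneral.electric_general` / `cornerC` for the vector layer):

 * §1 **`sum_normSq_LapS_add_cornerTerm`** — for EVERY `z` and EVERY finite `Ω ⊂ Tor N` (no support hypothesis, no shape hypothesis):
   `Σ_{x∈Ω}|(Δz)(x)|² + cornerTerm c Ω z = Hdiag c Ω z + Hmixed c z`, where
   `cornerTerm c Ω z := Σ_{x∉Ω} (|(Δz)(x)|² − Σ_μ |(P_μ z)(x)|²)` is the exterior defect of the pointwise Cauchy–Schwarz (exact; module M-R's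
   torus identity at `Ω = ⊤` plus two `sum_add_sum_compl`);
 * §2 for `z` SUPPORTED IN `Ω`: at an exterior site `x ∉ Ω`, `(P_μ z)(x) = −c̄c·(z(x+e_μ) + z(x−e_μ))` vanishes unless `μ` is an ACTIVE
   direction (`x ± e_μ ∈ Ω`), so `|(Δz)(x)|² ≤ #act(x)·Σ_μ|(P_μz)(x)|²` and the pointwise corner defect is `≤ (#act(x) − 1)·Σ_μ|(P_μz)(x)|²` —
   NONPOSITIVE at every exterior site with at most one active direction (module M-R's corner-free case) and
   `≤ (d − 1)·2(c̄c)²·Σ_μ(|z(x+e_μ)|² + |z(x−e_μ)|²)` at a CORNER SITE (`2 ≤ #act(x)`: the re-entrant exterior sites, a codimension-2 layer);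
 * §3 **`hdiag_add_hmixed_le_corner`**: `Hdiag c Ω z + Hmixed c z ≤ Σ_{x∈Ω}|(Δz)(x)|² + 2(d−1)(c̄c)²·cornerMass Ω z` with
   **`cornerMass Ω z := Σ_{x corner site} Σ_μ (|z(x+e_μ)|² + |z(x−e_μ)|²)`** = the mass of `z` on the `Ω`-neighbours of the corner sites;
   `hdiag_le_corner`; **`hdiag_le_of_cornerVanish`**: if `z` vanishes on every neighbour of every corner site (e.g. `z = φ·w` with a cutoff
   `φ` killing the corner layer) then `Hdiag c Ω z ≤ Σ_{x∈Ω}|(Δz)(x)|²` with NO shape hypothesis on `Ω`; `cornerMass_eq_zero_of_cornerFree`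
   recovers module M-R's class;
 * §4 THE BUDGET OF A REGION DIRICHLET SOLUTION ON ANY UNION OF UNIT BLOCKS (road P2's currency `DirichletBoxTwoLevel.budget`, `Lam`):
   **`sum_budget_solExt_le_corner`** `Σ_μ budget M S n μ (solExt f) ≤ Lam d a′·nsq f + 2(d−1)·n⁴·cornerMass Ω_n (solExt f)` (NO `IsCoordBox`),
   and the LEVEL-DEPENDENT socket the owner's R42 (c) asks for: **`budget_le_of_cornerMass_lev`** — a displayed corner-mass growth
   `hτ : ∀ k f, n_k⁴·cornerMass Ω_{n_k} (solExt_{n_k} f) ≤ τ k·nsq f` yields leaf-06-g7's `hΛ` VERBATIM with `Λ k := Lam d a′ + 2(d−1)·τ k`.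
   So on re-entrant regions the displayed scalar budget IS the corner mass `τ_n(S) = sup_f n⁴·cornerMass(solExt_n f)/nsq f` of the region
   Dirichlet solution: trivially `≤ 2d·γ′⁻¹·n²`; (Bᵗ) at a geometric rate needs `τ_{n_k} ≤ τ₀·n_k·θ^{2k}` (growth strictly below `n`);
   the expected truth at a right-angled re-entrant edge is `≍ n^{2/3}` (leaf-07-g10's memo `t4/T4-EST-NE2-D1-REENTRANT.md`, scalar `Rhess`).

HONEST FRAMING (T4-DAG p. 1).  [folklore] finite lattice calculus on the cell's typed `U = 1` objects (one region, finite torus); the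
corner mass is DISPLAYED, not bounded — nothing about its growth is proved here; nothing about [B9]'s printed regions; `hinjK` ∕ W3 off
boxes OPEN; Δ1 NOT closed; NE2 (U1a) NOT proved; spine PROVED 0/9 unchanged; NOT [B9] (3.16)/(3.23)–(3.27)/(3.42) as printed; NOT infinite
volume, NOT a mass gap, NOT the Clay problem.  HONEST DEPENDENCY: continuum YM on T⁴ ⇐ BetaPertH ∧ nine spine estimates (0/9 proved);
BetaPertH ⇐ (D1) ∧ (D4) ∧ CAP+tail; G-an2-4 gates asym, D1 and NE2/3/4.  No `sorry`.
-/

noncomputable section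

open scoped BigOperators ComplexConjugate Matrix
open Finset

namespace Summit.QuantumFields.BalabanUV.T4Continuum.DirichletCornerRegularity

open Literature.MathematicalPhysics.QuantumFieldTheory.Balaban1983to89.B5Prop11Plancherel (Tor fine unitVec)
open Literature.MathematicalPhysics.QuantumFieldTheory.Balaban1983to89.B5Action121 (sdiff LapS)
open Literature.MathematicalPhysics.QuantumFieldTheory.Balaban1983to89.B5Prop11Lower (nsq nsq_nonneg)
open Summit.QuantumFields.BalabanUV.T4Continuum
open Summit.QuantumFields.BalabanUV.T4Continuum.ScalarAveragedPropagator (gammaPs gammaPs_pos)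
open Summit.QuantumFields.BalabanUV.Beta.GAN24.DirichletBoxRegularity (Pdir Pdir_mulVec LapS_mulVec_eq_sum SuppIn CornerFree Hdiag Hmixed
  hmixed_nonneg Pdir_mulVec_eq_zero_of_not_mem sum_normSq_LapS_eq)
open Summit.QuantumFields.BalabanUV.Beta.GAN24.DirichletBoxCompression (solExt solExt_apply_of_not dirichlet_solExt_le sum_normSq_LapS_solExt_le)
open Summit.QuantumFields.BalabanUV.Beta.GAN24.DirichletBoxTrace (blockReg)
open Summit.QuantumFields.BalabanUV.Beta.GAN24.DirichletBoxTwoLevel (budget Lam)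

variable {d : ℕ} {N : Fin d → ℕ} [hN : ∀ μ, NeZero (N μ)]

/-! ## §1 The `H²` identity with its exterior defect, on an arbitrary region -/

/-- the EXTERIOR CORNER TERM of the region `Ω`: `Σ_{x∉Ω} (|(Δz)(x)|² − Σ_μ |(P_μ z)(x)|²)` — the defect of the pointwise identity
`|Σ_μ a_μ|² = Σ_μ |a_μ|²` at the exterior sites (it vanishes wherever at most one direction is active). [folklore] -/
def cornerTerm (c : ℂ) (Ω : Finset (Tor N)) (z : Tor N → ℂ) : ℝ :=
  ∑ x ∈ Ωᶜ, (‖(LapS N c *ᵥ z) x‖ ^ 2 - ∑ μ, ‖(Pdir N c μ *ᵥ z) x‖ ^ 2)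

/-- the torus has no exterior: `CornerFree ⊤`. [folklore] -/
theorem cornerFree_univ : CornerFree N (univ : Finset (Tor N)) := fun x hx => absurd (mem_univ x) hx

/-- every `z` is supported in `⊤`. [folklore] -/
theorem suppIn_univ (z : Tor N → ℂ) : SuppIn N (univ : Finset (Tor N)) z := fun x hx => absurd (mem_univ x) hx

/-- **THE DISCRETE `H²` IDENTITY ON AN ARBITRARY REGION** (every `z`, every finite `Ω`; no support and no shape hypothesis):
`Σ_{x∈Ω}|(Δz)(x)|² + cornerTerm c Ω z = Hdiag c Ω z + Hmixed c z`. [folklore] -/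
theorem sum_normSq_LapS_add_cornerTerm (c : ℂ) (Ω : Finset (Tor N)) (z : Tor N → ℂ) :
    ∑ x ∈ Ω, ‖(LapS N c *ᵥ z) x‖ ^ 2 + cornerTerm c Ω z = Hdiag c Ω z + Hmixed c z := by
  -- the torus identity `Σ_x |Δz|² = Σ_μ Σ_x |P_μ z|² + Hmixed`
  have htor : ∑ x ∈ (univ : Finset (Tor N)), ‖(LapS N c *ᵥ z) x‖ ^ 2 = Hdiag c univ z + Hmixed c z :=
    sum_normSq_LapS_eq cornerFree_univ (suppIn_univ z) c
  have h1 : ∑ x ∈ Ω, ‖(LapS N c *ᵥ z) x‖ ^ 2 + ∑ x ∈ Ωᶜ, ‖(LapS N c *ᵥ z) x‖ ^ 2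
      = ∑ x ∈ (univ : Finset (Tor N)), ‖(LapS N c *ᵥ z) x‖ ^ 2 := sum_add_sum_compl Ω _
  have h2 : Hdiag c univ z = Hdiag c Ω z + ∑ x ∈ Ωᶜ, ∑ μ, ‖(Pdir N c μ *ᵥ z) x‖ ^ 2 := by
    unfold Hdiag
    rw [Finset.sum_comm (s := Ωᶜ), ← sum_add_distrib]
    exact sum_congr rfl fun μ _ => (sum_add_sum_compl Ω _).symm
  unfold cornerTerm
  rw [sum_sub_distrib]
  linarith

/-! ## §2 Exterior sites of a supported function: active directions and the pointwise defect -/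

/-- the ACTIVE directions of a site `x` w.r.t. `Ω`: those `μ` with `x + e_μ ∈ Ω` or `x − e_μ ∈ Ω`. [folklore] -/
def act (Ω : Finset (Tor N)) (x : Tor N) : Finset (Fin d) := univ.filter fun μ => x + unitVec N μ ∈ Ω ∨ x - unitVec N μ ∈ Ω

omit hN in
/-- `#act(x) ≤ d`. [folklore] -/
theorem card_act_le (Ω : Finset (Tor N)) (x : Tor N) : (act Ω x).card ≤ d :=
  (card_filter_le _ _).trans (by rw [card_univ, Fintype.card_fin])

/-- at an exterior site an INACTIVE direction carries no `P_μ z` (module M-R's vanishing lemma). [folklore] -/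
theorem Pdir_mulVec_eq_zero_of_not_act {Ω : Finset (Tor N)} {z : Tor N → ℂ} (hz : SuppIn N Ω z) (c : ℂ) {x : Tor N} (hx : x ∉ Ω)
    {μ : Fin d} (hμ : μ ∉ act Ω x) : (Pdir N c μ *ᵥ z) x = 0 := by
  simp only [act, mem_filter, mem_univ, true_and, not_or] at hμ
  exact Pdir_mulVec_eq_zero_of_not_mem hz c hx hμ.1 hμ.2

/-- at an exterior site `(Δz)(x) = Σ_{μ active} (P_μ z)(x)`. [folklore] -/
theorem LapS_mulVec_eq_sum_act {Ω : Finset (Tor N)} {z : Tor N → ℂ} (hz : SuppIn N Ω z) (c : ℂ) {x : Tor N} (hx : x ∉ Ω) :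
    (LapS N c *ᵥ z) x = ∑ μ ∈ act Ω x, (Pdir N c μ *ᵥ z) x := by
  rw [LapS_mulVec_eq_sum]
  exact (sum_subset (subset_univ _) fun μ _ hμ => Pdir_mulVec_eq_zero_of_not_act hz c hx hμ).symm

/-- likewise `Σ_μ |(P_μ z)(x)|² = Σ_{μ active} |(P_μ z)(x)|²`. [folklore] -/
theorem sum_normSq_Pdir_eq_sum_act {Ω : Finset (Tor N)} {z : Tor N → ℂ} (hz : SuppIn N Ω z) (c : ℂ) {x : Tor N} (hx : x ∉ Ω) :
    ∑ μ, ‖(Pdir N c μ *ᵥ z) x‖ ^ 2 = ∑ μ ∈ act Ω x, ‖(Pdir N c μ *ᵥ z) x‖ ^ 2 :=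
  (sum_subset (subset_univ _) fun μ _ hμ => by rw [Pdir_mulVec_eq_zero_of_not_act hz c hx hμ, norm_zero, zero_pow two_ne_zero]).symm

/-- **pointwise Cauchy–Schwarz at an exterior site**: `|(Δz)(x)|² ≤ #act(x)·Σ_μ |(P_μ z)(x)|²`. [folklore] -/
theorem normSq_LapS_le_card_act_mul {Ω : Finset (Tor N)} {z : Tor N → ℂ} (hz : SuppIn N Ω z) (c : ℂ) {x : Tor N} (hx : x ∉ Ω) :
    ‖(LapS N c *ᵥ z) x‖ ^ 2 ≤ (act Ω x).card * ∑ μ, ‖(Pdir N c μ *ᵥ z) x‖ ^ 2 := by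
  rw [LapS_mulVec_eq_sum_act hz c hx, sum_normSq_Pdir_eq_sum_act hz c hx]
  calc ‖∑ μ ∈ act Ω x, (Pdir N c μ *ᵥ z) x‖ ^ 2 ≤ (∑ μ ∈ act Ω x, ‖(Pdir N c μ *ᵥ z) x‖) ^ 2 :=
        pow_le_pow_left₀ (norm_nonneg _) (norm_sum_le _ _) 2
    _ ≤ (act Ω x).card * ∑ μ ∈ act Ω x, ‖(Pdir N c μ *ᵥ z) x‖ ^ 2 := sq_sum_le_card_mul_sum_sq

/-- the pointwise corner defect is `≤ (#act(x) − 1)·Σ_μ |(P_μ z)(x)|²`; in particular NONPOSITIVE where at most one direction is active.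
[folklore] -/
theorem defect_le_card_act_sub_one_mul {Ω : Finset (Tor N)} {z : Tor N → ℂ} (hz : SuppIn N Ω z) (c : ℂ) {x : Tor N} (hx : x ∉ Ω) :
    ‖(LapS N c *ᵥ z) x‖ ^ 2 - ∑ μ, ‖(Pdir N c μ *ᵥ z) x‖ ^ 2 ≤ (((act Ω x).card : ℝ) - 1) * ∑ μ, ‖(Pdir N c μ *ᵥ z) x‖ ^ 2 := by
  have h := normSq_LapS_le_card_act_mul hz c hx
  linarith

/-- at an exterior site `(P_μ z)(x) = −c̄c·(z(x+e_μ) + z(x−e_μ))`. [folklore] -/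
theorem Pdir_mulVec_of_not_mem {Ω : Finset (Tor N)} {z : Tor N → ℂ} (hz : SuppIn N Ω z) (c : ℂ) (μ : Fin d) {x : Tor N}
    (hx : x ∉ Ω) : (Pdir N c μ *ᵥ z) x = -(conj c * c) * (z (x + unitVec N μ) + z (x - unitVec N μ)) := by
  rw [Pdir_mulVec, hz x hx]
  ring

/-- hence `|(P_μ z)(x)|² ≤ 2(c̄c)²·(|z(x+e_μ)|² + |z(x−e_μ)|²)` at an exterior site (`(c̄c)² = ‖c‖⁴`). [folklore] -/
theorem normSq_Pdir_le_of_not_mem {Ω : Finset (Tor N)} {z : Tor N → ℂ} (hz : SuppIn N Ω z) (c : ℂ) (μ : Fin d) {x : Tor N}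
    (hx : x ∉ Ω) :
    ‖(Pdir N c μ *ᵥ z) x‖ ^ 2 ≤ 2 * (‖c‖ ^ 2) ^ 2 * (‖z (x + unitVec N μ)‖ ^ 2 + ‖z (x - unitVec N μ)‖ ^ 2) := by
  rw [Pdir_mulVec_of_not_mem hz c μ hx, norm_mul, norm_neg, norm_mul, Complex.norm_conj, mul_pow]
  have hcc : (‖c‖ * ‖c‖) ^ 2 = (‖c‖ ^ 2) ^ 2 := by ring
  rw [hcc]
  have hsum : ‖z (x + unitVec N μ) + z (x - unitVec N μ)‖ ^ 2 ≤ 2 * (‖z (x + unitVec N μ)‖ ^ 2 + ‖z (x - unitVec N μ)‖ ^ 2) := by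
    have h1 := norm_add_le (z (x + unitVec N μ)) (z (x - unitVec N μ))
    have h2 : (‖z (x + unitVec N μ)‖ + ‖z (x - unitVec N μ)‖) ^ 2
        ≤ 2 * (‖z (x + unitVec N μ)‖ ^ 2 + ‖z (x - unitVec N μ)‖ ^ 2) := by
      nlinarith [sq_nonneg (‖z (x + unitVec N μ)‖ - ‖z (x - unitVec N μ)‖)]
    exact (pow_le_pow_left₀ (norm_nonneg _) h1 2).trans h2
  calc (‖c‖ ^ 2) ^ 2 * ‖z (x + unitVec N μ) + z (x - unitVec N μ)‖ ^ 2
      ≤ (‖c‖ ^ 2) ^ 2 * (2 * (‖z (x + unitVec N μ)‖ ^ 2 + ‖z (x - unitVec N μ)‖ ^ 2)) :=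
        mul_le_mul_of_nonneg_left hsum (by positivity)
    _ = _ := by ring

/-! ## §3 Corner sites, the corner mass, and the `H²` inequality on an arbitrary region -/

/-- the CORNER SITES of `Ω`: exterior sites with at least two active directions (the re-entrant exterior sites; for a union of unit
blocks, the exterior sites on the codimension-2 edges of the holes where two faces of `Ω` meet at the opening `3π/2`). [folklore] -/
def cornerSites (Ω : Finset (Tor N)) : Finset (Tor N) := Ωᶜ.filter fun x => 2 ≤ (act Ω x).card

/-- the CORNER MASS of `z`: its mass on the neighbours of the corner sites, `Σ_{x corner} Σ_μ (|z(x+e_μ)|² + |z(x−e_μ)|²)`. [folklore] -/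
def cornerMass (Ω : Finset (Tor N)) (z : Tor N → ℂ) : ℝ :=
  ∑ x ∈ cornerSites Ω, ∑ μ, (‖z (x + unitVec N μ)‖ ^ 2 + ‖z (x - unitVec N μ)‖ ^ 2)

/-- `0 ≤ cornerMass`. [folklore] -/
theorem cornerMass_nonneg (Ω : Finset (Tor N)) (z : Tor N → ℂ) : 0 ≤ cornerMass Ω z :=
  sum_nonneg fun _ _ => sum_nonneg fun _ _ => by positivity

/-- the pointwise corner defect of a supported `z` at an exterior site is bounded by the indicator of the corner sites times
`(d − 1)·2(c̄c)²·Σ_μ (|z(x+e_μ)|² + |z(x−e_μ)|²)`. [folklore] -/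
theorem defect_le_ite {Ω : Finset (Tor N)} {z : Tor N → ℂ} (hz : SuppIn N Ω z) (c : ℂ) {x : Tor N} (hx : x ∉ Ω) :
    ‖(LapS N c *ᵥ z) x‖ ^ 2 - ∑ μ, ‖(Pdir N c μ *ᵥ z) x‖ ^ 2
      ≤ if 2 ≤ (act Ω x).card then
          ((d : ℝ) - 1) * (2 * (‖c‖ ^ 2) ^ 2 * ∑ μ, (‖z (x + unitVec N μ)‖ ^ 2 + ‖z (x - unitVec N μ)‖ ^ 2)) else 0 := by
  have hdef := defect_le_card_act_sub_one_mul hz c hx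
  have hS0 : 0 ≤ ∑ μ, ‖(Pdir N c μ *ᵥ z) x‖ ^ 2 := sum_nonneg fun _ _ => by positivity
  split_ifs with h2
  · have hcard : ((act Ω x).card : ℝ) - 1 ≤ (d : ℝ) - 1 := by
      have := card_act_le Ω x
      exact sub_le_sub_right (by exact_mod_cast this) 1
    have hd1 : 0 ≤ (d : ℝ) - 1 := by
      have : (2 : ℝ) ≤ (act Ω x).card := by exact_mod_cast h2
      linarith
    have hP : ∑ μ, ‖(Pdir N c μ *ᵥ z) x‖ ^ 2 ≤ 2 * (‖c‖ ^ 2) ^ 2 * ∑ μ, (‖z (x + unitVec N μ)‖ ^ 2 + ‖z (x - unitVec N μ)‖ ^ 2) := by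
      rw [mul_sum]
      exact sum_le_sum fun μ _ => normSq_Pdir_le_of_not_mem hz c μ hx
    calc ‖(LapS N c *ᵥ z) x‖ ^ 2 - ∑ μ, ‖(Pdir N c μ *ᵥ z) x‖ ^ 2
        ≤ (((act Ω x).card : ℝ) - 1) * ∑ μ, ‖(Pdir N c μ *ᵥ z) x‖ ^ 2 := hdef
      _ ≤ ((d : ℝ) - 1) * ∑ μ, ‖(Pdir N c μ *ᵥ z) x‖ ^ 2 := mul_le_mul_of_nonneg_right hcard hS0
      _ ≤ ((d : ℝ) - 1) * (2 * (‖c‖ ^ 2) ^ 2 * ∑ μ, (‖z (x + unitVec N μ)‖ ^ 2 + ‖z (x - unitVec N μ)‖ ^ 2)) :=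
          mul_le_mul_of_nonneg_left hP hd1
  · have hcard : ((act Ω x).card : ℝ) - 1 ≤ 0 := by
      have : (act Ω x).card ≤ 1 := by omega
      have : ((act Ω x).card : ℝ) ≤ 1 := by exact_mod_cast this
      linarith
    exact hdef.trans (mul_nonpos_of_nonpos_of_nonneg hcard hS0)

/-- **THE CORNER TERM OF A SUPPORTED FUNCTION IS BOUNDED BY ITS CORNER MASS**:
`cornerTerm c Ω z ≤ 2(d−1)(c̄c)²·cornerMass Ω z`. [folklore] -/
theorem cornerTerm_le_cornerMass {Ω : Finset (Tor N)} {z : Tor N → ℂ} (hz : SuppIn N Ω z) (c : ℂ) :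
    cornerTerm c Ω z ≤ 2 * ((d : ℝ) - 1) * (‖c‖ ^ 2) ^ 2 * cornerMass Ω z := by
  unfold cornerTerm cornerMass cornerSites
  rw [sum_filter, mul_sum]
  refine sum_le_sum fun x hx => ?_
  have hx' : x ∉ Ω := mem_compl.mp hx
  refine (defect_le_ite hz c hx').trans (le_of_eq ?_)
  split_ifs <;> ring

/-- **THE DISCRETE `H²` INEQUALITY ON AN ARBITRARY REGION** (`z` supported in `Ω`):
`Hdiag c Ω z + Hmixed c z ≤ Σ_{x∈Ω}|(Δz)(x)|² + 2(d−1)(c̄c)²·cornerMass Ω z`. [folklore] -/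
theorem hdiag_add_hmixed_le_corner {Ω : Finset (Tor N)} {z : Tor N → ℂ} (hz : SuppIn N Ω z) (c : ℂ) :
    Hdiag c Ω z + Hmixed c z ≤ ∑ x ∈ Ω, ‖(LapS N c *ᵥ z) x‖ ^ 2 + 2 * ((d : ℝ) - 1) * (‖c‖ ^ 2) ^ 2 * cornerMass Ω z := by
  have h := sum_normSq_LapS_add_cornerTerm c Ω z
  have hc := cornerTerm_le_cornerMass hz c
  linarith

/-- the INTERIOR DIAGONAL HESSIAN of a supported function on an arbitrary region:
`Hdiag c Ω z ≤ Σ_{x∈Ω}|(Δz)(x)|² + 2(d−1)(c̄c)²·cornerMass Ω z`. [folklore] -/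
theorem hdiag_le_corner {Ω : Finset (Tor N)} {z : Tor N → ℂ} (hz : SuppIn N Ω z) (c : ℂ) :
    Hdiag c Ω z ≤ ∑ x ∈ Ω, ‖(LapS N c *ᵥ z) x‖ ^ 2 + 2 * ((d : ℝ) - 1) * (‖c‖ ^ 2) ^ 2 * cornerMass Ω z :=
  le_trans (le_add_of_nonneg_right (hmixed_nonneg c z)) (hdiag_add_hmixed_le_corner hz c)

/-- a function VANISHING ON THE CORNER LAYER of `Ω` (at every neighbour of every corner site) has no corner mass. [folklore] -/
theorem cornerMass_eq_zero_of_cornerVanish {Ω : Finset (Tor N)} {z : Tor N → ℂ}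
    (h : ∀ x ∈ cornerSites Ω, ∀ μ, z (x + unitVec N μ) = 0 ∧ z (x - unitVec N μ) = 0) : cornerMass Ω z = 0 := by
  refine sum_eq_zero fun x hx => sum_eq_zero fun μ _ => ?_
  rw [(h x hx μ).1, (h x hx μ).2, norm_zero, zero_pow two_ne_zero, add_zero]

/-- **THE CUTOFF FORM** (no shape hypothesis on `Ω`): a function supported in `Ω` and vanishing on the corner layer satisfies module M-R's
corner-free inequality `Hdiag c Ω z ≤ Σ_{x∈Ω}|(Δz)(x)|²` (and `Hdiag + Hmixed ≤ …`).  Typical use: `z = φ·w` with a cutoff `φ` that kills the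
neighbours of the re-entrant edges. [folklore] -/
theorem hdiag_le_of_cornerVanish {Ω : Finset (Tor N)} {z : Tor N → ℂ} (hz : SuppIn N Ω z)
    (hv : ∀ x ∈ cornerSites Ω, ∀ μ, z (x + unitVec N μ) = 0 ∧ z (x - unitVec N μ) = 0) (c : ℂ) :
    Hdiag c Ω z + Hmixed c z ≤ ∑ x ∈ Ω, ‖(LapS N c *ᵥ z) x‖ ^ 2 := by
  have h := hdiag_add_hmixed_le_corner hz c
  rwa [cornerMass_eq_zero_of_cornerVanish hv, mul_zero, add_zero] at h

/-- a CORNER-FREE region (module M-R) has no corner sites, hence no corner mass. [folklore] -/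
theorem cornerMass_eq_zero_of_cornerFree {Ω : Finset (Tor N)} (hΩ : CornerFree N Ω) (z : Tor N → ℂ) : cornerMass Ω z = 0 := by
  refine sum_eq_zero fun x hx => ?_
  exfalso
  rw [cornerSites, mem_filter, mem_compl] at hx
  obtain ⟨hxΩ, h2⟩ := hx
  -- two distinct active directions contradict `CornerFree`
  obtain ⟨μ, ν, hμ, hν, hμν⟩ := one_lt_card_iff.mp h2
  simp only [act, mem_filter, mem_univ, true_and] at hμ hν
  obtain ⟨hp, hm⟩ := hΩ x hxΩ μ ν hμν hμ
  exact hν.elim hp hm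

/-! ## §4 The budget of a region Dirichlet solution on any union of unit blocks -/

section Budget

variable (n : ℕ) [NeZero n] (M : Fin d → ℕ) [hM : ∀ μ, NeZero (M μ)] (S : Tor M → Prop) [DecidablePred S] {a' : ℝ}

/-- **THE BUDGET OF A ZERO-EXTENDED REGION DIRICHLET SOLUTION ON ANY UNION OF UNIT BLOCKS** (no `IsCoordBox`): for any decidable spelling
`p` of `Ω = blockReg n S`, `Σ_μ budget_μ(solExt_p f) ≤ Lam d a′·‖f‖² + 2(d−1)·n⁴·cornerMass Ω (solExt_p f)` — road P2's
`sum_budget_solExt_le` with the corner-free `H²` step replaced by §3. [folklore] -/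
theorem sum_budget_solExt_le_corner (ha' : 0 < a') (p : Tor (fine n M) → Prop) [DecidablePred p] (hp : ∀ x, p x ↔ blockReg n M S x)
    (f : {x // p x} → ℂ) :
    ∑ μ, budget M S n μ (solExt n M a' p f)
      ≤ Lam d a' * nsq f + 2 * ((d : ℝ) - 1) * (n : ℝ) ^ 4 * cornerMass (univ.filter (blockReg n M S)) (solExt n M a' p f) := by
  set u := solExt n M a' p f with hu
  have hsupp : SuppIn (fine n M) (univ.filter (blockReg n M S)) u := by
    intro x hx
    rw [Finset.mem_filter] at hx
    exact solExt_apply_of_not n M a' p f (fun h => hx ⟨Finset.mem_univ _, (hp x).mp h⟩)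
  have hD : ∑ μ, nsq (sdiff (fine n M) (n : ℂ) μ *ᵥ u) ≤ (gammaPs d a')⁻¹ * nsq f := dirichlet_solExt_le n M a' _ ha' f
  have hn4 : (‖(n : ℂ)‖ ^ 2) ^ 2 = (n : ℝ) ^ 4 := by rw [Complex.norm_natCast]; ring
  have hH : ∑ μ, ∑ x ∈ univ.filter (blockReg n M S), ‖(Pdir (fine n M) (n : ℂ) μ *ᵥ u) x‖ ^ 2
      ≤ 2 * (1 + (a' * (gammaPs d a')⁻¹) ^ 2) * nsq f
        + 2 * ((d : ℝ) - 1) * (n : ℝ) ^ 4 * cornerMass (univ.filter (blockReg n M S)) u := by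
    have h1 : Hdiag (n : ℂ) (univ.filter (blockReg n M S)) u
        ≤ ∑ x ∈ univ.filter (blockReg n M S), ‖(LapS (fine n M) (n : ℂ) *ᵥ u) x‖ ^ 2
          + 2 * ((d : ℝ) - 1) * (‖(n : ℂ)‖ ^ 2) ^ 2 * cornerMass (univ.filter (blockReg n M S)) u := hdiag_le_corner hsupp (n : ℂ)
    have h2 : ∑ x ∈ univ.filter (blockReg n M S), ‖(LapS (fine n M) (n : ℂ) *ᵥ u) x‖ ^ 2
        = ∑ a : {x // p x}, ‖(LapS (fine n M) (n : ℂ) *ᵥ u) a‖ ^ 2 :=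
      Finset.sum_subtype _ (fun x => by simp [hp x]) (fun x => ‖(LapS (fine n M) (n : ℂ) *ᵥ u) x‖ ^ 2)
    have h3 := sum_normSq_LapS_solExt_le n M a' p ha' f
    rw [← hu] at h3
    rw [hn4] at h1
    exact h1.trans (by rw [h2]; linarith)
  calc ∑ μ, budget M S n μ u = ∑ μ, nsq (sdiff (fine n M) (n : ℂ) μ *ᵥ u)
        + ∑ μ, ∑ x ∈ univ.filter (blockReg n M S), ‖(Pdir (fine n M) (n : ℂ) μ *ᵥ u) x‖ ^ 2 := by
        rw [← Finset.sum_add_distrib]; rfl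
    _ ≤ (gammaPs d a')⁻¹ * nsq f + (2 * (1 + (a' * (gammaPs d a')⁻¹) ^ 2) * nsq f
        + 2 * ((d : ℝ) - 1) * (n : ℝ) ^ 4 * cornerMass (univ.filter (blockReg n M S)) u) := add_le_add hD hH
    _ = Lam d a' * nsq f + 2 * ((d : ℝ) - 1) * (n : ℝ) ^ 4 * cornerMass (univ.filter (blockReg n M S)) u := by rw [Lam]; ring

/-- **THE DISPLAYED SCALAR BUDGET REDUCED TO THE CORNER MASS** (one level): a corner-mass bound
`n⁴·cornerMass Ω (solExt f) ≤ τ·‖f‖²` gives `Σ_μ budget_μ(solExt f) ≤ (Lam d a′ + 2(d−1)τ)·‖f‖²` — leaf-06-g7's `hΛ` with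
`Λ := Lam d a′ + 2(d−1)τ` (`1 ≤ d`). [folklore] -/
theorem budget_le_of_cornerMass (hd : 1 ≤ d) (ha' : 0 < a') {τ : ℝ}
    (hτ : ∀ f : {x // blockReg n M S x} → ℂ,
      (n : ℝ) ^ 4 * cornerMass (univ.filter (blockReg n M S)) (solExt n M a' (blockReg n M S) f) ≤ τ * nsq f)
    (f : {x // blockReg n M S x} → ℂ) :
    ∑ μ, budget M S n μ (solExt n M a' (blockReg n M S) f) ≤ (Lam d a' + 2 * ((d : ℝ) - 1) * τ) * nsq f := by
  have h := sum_budget_solExt_le_corner n M S ha' (blockReg n M S) (fun _ => Iff.rfl) f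
  have hd' : 0 ≤ 2 * ((d : ℝ) - 1) := by
    have : (1 : ℝ) ≤ d := by exact_mod_cast hd
    linarith
  calc ∑ μ, budget M S n μ (solExt n M a' (blockReg n M S) f)
      ≤ Lam d a' * nsq f + 2 * ((d : ℝ) - 1) * (n : ℝ) ^ 4 * cornerMass (univ.filter (blockReg n M S)) (solExt n M a' (blockReg n M S) f) := h
    _ = Lam d a' * nsq f + 2 * ((d : ℝ) - 1) * ((n : ℝ) ^ 4 * cornerMass (univ.filter (blockReg n M S)) (solExt n M a' (blockReg n M S) f)) := by
        ring
    _ ≤ Lam d a' * nsq f + 2 * ((d : ℝ) - 1) * (τ * nsq f) := by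
        have := mul_le_mul_of_nonneg_left (hτ f) hd'
        linarith
    _ = (Lam d a' + 2 * ((d : ℝ) - 1) * τ) * nsq f := by ring

end Budget

/-! ## §5 Along the tower: leaf-06-g7's `hΛ` from a displayed corner-mass growth -/

section Tower

open Literature.MathematicalPhysics.QuantumFieldTheory.Balaban1983to89.B5G183RateUnitTower (lev)

variable (L : ℕ) [NeZero L] (M : Fin d → ℕ) [hM : ∀ μ, NeZero (M μ)] (S : Tor M → Prop) [DecidablePred S] {a' : ℝ}

/-- **THE LEVEL-DEPENDENT SOCKET** (owner R42 (c)): a displayed corner-mass growth along the tower,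
`hτ : ∀ k f, n_k⁴·cornerMass Ω_{n_k} (solExt_{n_k} f) ≤ τ k·‖f‖²`, yields leaf-06-g7's budget hypothesis `hΛ` of
`RegionGaugeColumnsTraceRegion.hBt_of_hB_of_budget` / `hinjK_of_local_of_coercive_of_budget` VERBATIM with `Λ k := Lam d a′ + 2(d−1)·τ k`
(and `0 ≤ Λ k` from `0 ≤ τ k`).  For (Bᵗ) at a geometric rate `θ` that file then needs `√(2Λ_k/n_k) ≤ CH·θ^k`, i.e. a corner-mass growth
STRICTLY BELOW `n_k`. [folklore] -/
theorem budget_le_of_cornerMass_lev (hd : 1 ≤ d) (ha' : 0 < a') {τ : ℕ → ℝ}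
    (hτ : ∀ (k : ℕ) (f : {x // blockReg (lev L k) M S x} → ℂ),
      ((lev L k : ℕ) : ℝ) ^ 4 * cornerMass (univ.filter (blockReg (lev L k) M S)) (solExt (lev L k) M a' (blockReg (lev L k) M S) f)
        ≤ τ k * nsq f)
    (k : ℕ) (f : {x // blockReg (lev L k) M S x} → ℂ) :
    ∑ μ, budget M S (lev L k) μ (solExt (lev L k) M a' (blockReg (lev L k) M S) f) ≤ (Lam d a' + 2 * ((d : ℝ) - 1) * τ k) * nsq f :=
  budget_le_of_cornerMass (lev L k) M S hd ha' (hτ k) f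

/-- the socket's constants are nonnegative when `1 ≤ d` and `0 ≤ τ k`. [folklore] -/
theorem Lam_add_nonneg (hd : 1 ≤ d) {τ : ℕ → ℝ} (hτ0 : ∀ k, 0 ≤ τ k) (k : ℕ) : 0 ≤ Lam d a' + 2 * ((d : ℝ) - 1) * τ k := by
  have hΛ : 0 ≤ Lam d a' := by
    have := (gammaPs_pos (d := d) (a' := a')).1
    unfold Lam; positivity
  have hd' : (1 : ℝ) ≤ d := by exact_mod_cast hd
  have := hτ0 k
  nlinarith

end Tower

end Summit.QuantumFields.BalabanUV.T4Continuum.DirichletCornerRegularity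

end
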